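import Summits.BirchSwinnertonDyer.BirchSwinnertonDyer.Theorems.TwoAdicConverseOrdLambdaHalfAtTwoWbarRealQuadratic
import Summits.BirchSwinnertonDyer.BirchSwinnertonDyer.Theorems.PrintCFramBottomClassIndexLawFiveLeHerbrandSelmerToHomPrimes
import Literature.NumberTheory.GaloisRepresentations.AbsGaloisInvolutionsRealPlacePerm
import HarnessLib

/-!
# Route `TwoAdicConverse` (rung S3), crux `OrdLambdaHalfAtTwo` (item stmt-BirchSwinnertonDyer-19556), line
# `kato-determinant-greenberg-two`, stub `stub_wbarStepAtTwo` ([C]) — brick R1: **no layer `ℚ_n` of the cyclotomic `ℤ₂`-tower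
# has a quadratic extension unramified at the odd primes and at `∞` other than `ℚ_{n+1}`** (layer induction, no class field theory)

Cell `bsd-2adic`, seat `bsd-2adic-conv-1` GEN 26 (`--supports` stmt-BirchSwinnertonDyer-19556, helper; pen RC-325, sub-lemma (h2) of the
cor–Ver road).  FUNCTION FORM: `Γ_n = Gal(ℚ̄/ℚ_n) = κ_cyc⁻¹(2ⁿℤ₂)`, `M` an abelian group of order `2`; a «quadratic character of `ℚ_n`»
is a function `χ : Γ_ℚ → M` additive on `Γ_n` with a kernel open in `Γ_ℚ`.  `layer_vanishing`: if such a `χ` kills every inertia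
group above every odd prime and every complex conjugation, then `χ` vanishes on `Γ_{n+1}`.  Induction on `n`: `n = 0` is brick R0
(`eq_layerSubgroup_one_of_index_two`, Kummer); step: for `s ∈ Γ_n ∖ Γ_{n+1}`, `d := χ + χ^s` is additive on `Γ_{n+1}`, `s`-invariant,
`d(s²) = 0`, so EXTENDS additively to `Γ_n` (`extend_add`) and vanishes by induction — `χ` is `s`-invariant; then `χ` (if `χ(s²) = 0`)
or `χ + ψ` (`ψ` the character of `ℚ_{n+2}/ℚ_{n+1}`) extends likewise.  HONEST FRAMING: theorems only (no definition, no named fact, no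
`sorry`); Galois bookkeeping over `ℚ`; BSD is not proved by any of this.  PARTITION (D-0054): none — RANK axis S3 × X5@2 stratum (β);
types-the-object-of (stub 3b-C).  References: [cite: Washington1997, §13.1 and Prop. 13.2]; [cite: Marcus2018, Ch. 4 Ex. 32].
-/

set_option autoImplicit false
-- the route's Theorems namespace repeats the summit name by design (D-0017 nested layout)
set_option linter.dupNamespace false

noncomputable section

open scoped Classical NumberField Pointwise

namespace Summit.BirchSwinnertonDyer.BirchSwinnertonDyer.Theorems.TwoAdicWbarStep

open Function NumberField IsDedekindDomain Field
  Literature.NumberTheory.GaloisRepresentations Literature.NumberTheory.EllipticCurves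

/-! ## §1. Groups of order `2`; index-`2` bookkeeping; the layers `Γ_n` -/

section OrderTwo

variable {M : Type*} [AddCommGroup M]

/-- In a group of order `2`, `a + a = 0`. [folklore] -/
theorem add_self_eq_zero_of_card_eq_two (hM : Nat.card M = 2) (a : M) : a + a = 0 := by
  haveI : Finite M := Nat.finite_of_card_ne_zero (by rw [hM]; norm_num)
  have h : Nat.card M • a = 0 := card_nsmul_eq_zero'
  rwa [hM, two_nsmul] at h

/-- In a group of order `2`, two non-zero elements are equal. [folklore] -/
theorem eq_of_ne_zero_of_card_eq_two (hM : Nat.card M = 2) {a b : M} (ha : a ≠ 0) (hb : b ≠ 0) : a = b := by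
  obtain ⟨x, y, hxy, hxy'⟩ := Nat.card_eq_two_iff.mp hM
  have hx : ∀ z : M, z = x ∨ z = y := fun z ↦ by
    have hz : z ∈ ({x, y} : Set M) := hxy' ▸ Set.mem_univ z
    simpa using hz
  rcases hx a with ha' | ha' <;> rcases hx b with hb' | hb' <;> rcases hx 0 with h0 | h0
  all_goals first | exact ha'.trans hb'.symm | exact absurd (ha'.trans h0.symm) ha | exact absurd (hb'.trans h0.symm) hb

/-- In a group of order `2`: `a + b = 0 ↔ a = b`. [folklore] -/
theorem add_eq_zero_iff_eq_of_card_eq_two (hM : Nat.card M = 2) {a b : M} : a + b = 0 ↔ a = b := by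
  rw [add_eq_zero_iff_eq_neg, neg_eq_iff_add_eq_zero.mpr (add_self_eq_zero_of_card_eq_two hM b)]

end OrderTwo

/-- **Index-`2` coset rule, relative form**: for `H ≤ K` with `[K : H] = 2` and `x, y ∈ K`, `x y ∈ H ↔ (x ∈ H ↔ y ∈ H)`.
[folklore] -/
theorem mul_mem_iff_of_relIndex_two {G : Type*} [Group G] {H K : Subgroup G} (h2 : H.relIndex K = 2)
    {x y : G} (hx : x ∈ K) (hy : y ∈ K) : x * y ∈ H ↔ (x ∈ H ↔ y ∈ H) := by
  have h := Subgroup.mul_mem_iff_of_index_two (H := H.subgroupOf K) h2 (a := ⟨x, hx⟩) (b := ⟨y, hy⟩)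
  simp only [Subgroup.mem_subgroupOf] at h
  exact h

section Layers

variable (κ : ZpExtension ℚ 2)

/-- `[Γ_n : Γ_{n+1}] = 2` for a `ℤ₂`-extension. [cite: Washington1997, §13.1] -/
theorem relIndex_layerSubgroup_succ (n : ℕ) : (κ.layerSubgroup (n + 1)).relIndex (κ.layerSubgroup n) = 2 := by
  have h := Subgroup.relIndex_mul_index (κ.layerSubgroup_antitone (Nat.le_succ n))
  rw [ZpExtension.index_layerSubgroup, ZpExtension.index_layerSubgroup, pow_succ] at h
  have h' : 2 ^ n * (κ.layerSubgroup (n + 1)).relIndex (κ.layerSubgroup n) = 2 ^ n * 2 := by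
    rw [mul_comm]; exact h
  exact Nat.eq_of_mul_eq_mul_left (Nat.pos_of_ne_zero (pow_ne_zero n two_ne_zero)) h'

/-- Coset rule in the tower: for `x, y ∈ Γ_n`, `x y ∈ Γ_{n+1} ↔ (x ∈ Γ_{n+1} ↔ y ∈ Γ_{n+1})`. [cite: Washington1997, §13.1] -/
theorem mul_mem_layerSubgroup_succ_iff (n : ℕ) {x y : absoluteGaloisGroup ℚ} (hx : x ∈ κ.layerSubgroup n)
    (hy : y ∈ κ.layerSubgroup n) :
    x * y ∈ κ.layerSubgroup (n + 1) ↔ (x ∈ κ.layerSubgroup (n + 1) ↔ y ∈ κ.layerSubgroup (n + 1)) :=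
  mul_mem_iff_of_relIndex_two (relIndex_layerSubgroup_succ κ n) hx hy

/-- There is `s ∈ Γ_n ∖ Γ_{n+1}`. [cite: Washington1997, §13.1] -/
theorem exists_mem_layerSubgroup_not_mem_succ (n : ℕ) :
    ∃ s : absoluteGaloisGroup ℚ, s ∈ κ.layerSubgroup n ∧ s ∉ κ.layerSubgroup (n + 1) := by
  by_contra h
  push Not at h
  have hle : κ.layerSubgroup n ≤ κ.layerSubgroup (n + 1) := fun s hs ↦ h s hs
  have hdvd := Subgroup.index_dvd_of_le hle
  rw [ZpExtension.index_layerSubgroup, ZpExtension.index_layerSubgroup] at hdvd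
  have := Nat.le_of_dvd (by positivity) hdvd
  have hlt : 2 ^ n < 2 ^ (n + 1) := Nat.pow_lt_pow_right (by norm_num) (Nat.lt_succ_self n)
  omega

/-- If `s ∈ Γ_n ∖ Γ_{n+1}` then `s² ∈ Γ_{n+1} ∖ Γ_{n+2}` (`κ(s²) = 2 κ(s)` has valuation exactly `n + 1`).
[cite: Washington1997, §13.1] -/
theorem sq_mem_layerSubgroup_succ_not_mem {n : ℕ} {s : absoluteGaloisGroup ℚ} (hs : s ∈ κ.layerSubgroup n)
    (hs' : s ∉ κ.layerSubgroup (n + 1)) :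
    s * s ∈ κ.layerSubgroup (n + 1) ∧ s * s ∉ κ.layerSubgroup (n + 2) := by
  refine ⟨(mul_mem_layerSubgroup_succ_iff κ n hs hs).mpr Iff.rfl, fun h2 ↦ hs' ?_⟩
  rw [ZpExtension.mem_layerSubgroup] at h2 ⊢
  rw [map_mul, toAdd_mul, ← two_mul] at h2
  simp only [Nat.cast_ofNat] at h2 ⊢
  rw [pow_succ, mul_comm ((2 : ℤ_[2]) ^ (n + 1)) 2] at h2
  exact (mul_dvd_mul_iff_left (two_ne_zero : (2 : ℤ_[2]) ≠ 0)).mp h2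

/-- Complex conjugations lie in `Gal(ℚ̄/ℚ_∞) = ker κ` (an involution has trivial image in the torsion-free `ℤ₂`).
[cite: Washington1997, §13.1] -/
theorem mem_kerSubgroup_of_isComplexConjugation {c₀ : absoluteGaloisGroup ℚ}
    (hc₀ : IsComplexConjugation (Rat.castHom ℝ) c₀) : c₀ ∈ κ.kerSubgroup := by
  rw [ZpExtension.mem_kerSubgroup]
  have h : κ c₀ * κ c₀ = 1 := by rw [← map_mul, ← pow_two, hc₀.sq_eq_one, map_one]
  have h' : (κ c₀).toAdd + (κ c₀).toAdd = 0 := by rw [← toAdd_mul, h, toAdd_one]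
  have h0 : (κ c₀).toAdd = 0 := by
    rw [← two_mul] at h'
    exact (mul_eq_zero.mp h').resolve_left two_ne_zero
  exact Multiplicative.toAdd.injective (by rw [h0, toAdd_one])

/-- Inertia groups above odd primes lie in every layer `Γ_n` of a CYCLOTOMIC `ℤ₂`-extension of `ℚ` (unramified outside `2`,
tree `inertia_le_kerSubgroup_of_isCyclotomic`). [cite: Washington1997, Prop. 13.2] -/
theorem inertia_le_layerSubgroup (hκ : κ.IsCyclotomic) {v : HeightOneSpectrum (𝓞 ℚ)} (hv : ((2 : ℕ) : 𝓞 ℚ) ∉ v.asIdeal)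
    {𝔓 : Ideal (absIntegers (𝓞 ℚ) ℚ)} (h𝔓 : 𝔓 ∈ v.primesAbove) (n : ℕ) :
    𝔓.inertia (absoluteGaloisGroup ℚ) ≤ κ.layerSubgroup n :=
  (ZpExtension.inertia_le_kerSubgroup_of_isCyclotomic κ hκ hv h𝔓).trans (κ.kerSubgroup_le_layerSubgroup n)

end Layers

/-! ## §2. Extending an `s`-invariant additive function across an index-`2` step -/

/-- **Extension across `Γ_{n+1} ≤ Γ_n`.**  Let `s ∈ Γ_n ∖ Γ_{n+1}` and `d : Γ_ℚ → M` be additive on `Γ_{n+1}`, invariant under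
`x ↦ s⁻¹ x s` there, with `d(s s) = 0`.  Then `g(x) := d(x)` (`x ∈ Γ_{n+1}`), `g(x) := d(x s⁻¹)` (`x ∈ Γ_n ∖ Γ_{n+1}`) is
additive on `Γ_n`.  (With `d = c + c^s` and `s` an involution this is the corestriction/transfer of `c`; in general it is
the elementary half of `H²(ℤ/2, M)`-bookkeeping.) [folklore] -/
theorem extend_add {M : Type*} [AddCommGroup M] (κ : ZpExtension ℚ 2) (n : ℕ) {s : absoluteGaloisGroup ℚ}
    (hs : s ∈ κ.layerSubgroup n) (hs' : s ∉ κ.layerSubgroup (n + 1)) (d g : absoluteGaloisGroup ℚ → M)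
    (hd : ∀ x ∈ κ.layerSubgroup (n + 1), ∀ y ∈ κ.layerSubgroup (n + 1), d (x * y) = d x + d y)
    (hinv : ∀ x ∈ κ.layerSubgroup (n + 1), d (s⁻¹ * x * s) = d x) (hs2 : d (s * s) = 0)
    (hg : ∀ x, g x = if x ∈ κ.layerSubgroup (n + 1) then d x else d (x * s⁻¹)) :
    ∀ x ∈ κ.layerSubgroup n, ∀ y ∈ κ.layerSubgroup n, g (x * y) = g x + g y := by
  set H := κ.layerSubgroup (n + 1) with hH
  have hsinv : s⁻¹ ∈ κ.layerSubgroup n := inv_mem hs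
  have hsinv' : s⁻¹ ∉ H := fun h ↦ hs' (by simpa using inv_mem h)
  -- coset rule: for `x ∈ Γ_n`, `x ∉ H ↔ x s⁻¹ ∈ H`
  have hoff : ∀ x ∈ κ.layerSubgroup n, x ∉ H → x * s⁻¹ ∈ H := fun x hx hxH ↦ by
    rw [mul_mem_layerSubgroup_succ_iff κ n hx hsinv]
    exact ⟨fun h ↦ absurd h hxH, fun h ↦ absurd h hsinv'⟩
  -- `d` is invariant under `x ↦ s x s⁻¹` as well
  have hinv' : ∀ x ∈ H, d (s * x * s⁻¹) = d x := fun x hx ↦ by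
    have hx' : s * x * s⁻¹ ∈ H := (κ.layerSubgroup_normal (n + 1)).conj_mem x hx s
    have h := hinv (s * x * s⁻¹) hx'
    rw [show s⁻¹ * (s * x * s⁻¹) * s = x by group] at h
    exact h.symm
  have hd1 : d 1 = 0 := by
    have h := hd 1 (one_mem _) 1 (one_mem _)
    rw [mul_one] at h
    exact left_eq_add.mp h
  intro x hx y hy
  by_cases hxH : x ∈ H <;> by_cases hyH : y ∈ H
  · -- both in `H`
    have hxy : x * y ∈ H := mul_mem hxH hyH
    rw [hg, hg x, hg y, if_pos hxy, if_pos hxH, if_pos hyH]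
    exact hd x hxH y hyH
  · -- `x ∈ H`, `y ∉ H`
    have hxy : x * y ∉ H := fun h ↦ hyH ((mul_mem_cancel_left hxH).mp h)
    rw [hg, hg x, hg y, if_neg hxy, if_pos hxH, if_neg hyH, mul_assoc]
    exact hd x hxH _ (hoff y hy hyH)
  · -- `x ∉ H`, `y ∈ H`
    have hxy : x * y ∉ H := fun h ↦ hxH ((mul_mem_cancel_right hyH).mp h)
    rw [hg, hg x, hg y, if_neg hxy, if_neg hxH, if_pos hyH]
    have e : x * y * s⁻¹ = (x * s⁻¹) * (s * y * s⁻¹) := by group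
    rw [e, hd _ (hoff x hx hxH) _ ((κ.layerSubgroup_normal (n + 1)).conj_mem y hyH s), hinv' y hyH]
  · -- both off `H`
    have hxy : x * y ∈ H := by
      rw [mul_mem_layerSubgroup_succ_iff κ n hx hy]
      exact ⟨fun h ↦ absurd h hxH, fun h ↦ absurd h hyH⟩
    rw [hg, hg x, hg y, if_pos hxy, if_neg hxH, if_neg hyH]
    have hys : s * y ∈ H := by
      rw [mul_mem_layerSubgroup_succ_iff κ n hs hy]
      exact ⟨fun h ↦ absurd h hs', fun h ↦ absurd h hyH⟩
    have e : x * y = (x * s⁻¹) * (s * y) := by group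
    rw [e, hd _ (hoff x hx hxH) _ hys]
    congr 1
    -- `d (s y) = d (s s · s⁻¹ (y s⁻¹) s) = d (s s) + d (y s⁻¹)`
    have e2 : s * y = (s * s) * (s⁻¹ * (y * s⁻¹) * s) := by group
    have hss : s * s ∈ H := (sq_mem_layerSubgroup_succ_not_mem κ hs hs').1
    have hc : s⁻¹ * (y * s⁻¹) * s ∈ H := by
      have := (κ.layerSubgroup_normal (n + 1)).conj_mem _ (hoff y hy hyH) s⁻¹
      rwa [inv_inv] at this
    rw [e2, hd _ hss _ hc, hs2, zero_add, hinv _ (hoff y hy hyH)]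

/-! ## §3. The layer induction -/

set_option synthInstance.maxHeartbeats 100000 in
-- the pointwise `MulAction` of `Γ_ℚ` on the ideals of `\bar ℤ` is found slowly under these imports (as in `…SelmerToHomPrimes`)
/-- **Layer vanishing** (`Claim(n)` for every `n`).  For the normalised cyclotomic `ℤ₂`-extension `κ_cyc` of `ℚ` with layers
`Γ_n`, an abelian group `M` of order `2` and `χ : Γ_ℚ → M` additive on `Γ_n`, vanishing on an open subgroup of `Γ_ℚ` inside
`Γ_n`, on every inertia group above every odd prime and on every complex conjugation: `χ` vanishes on `Γ_{n+1}`.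
[cite: Washington1997, §13.1] [cite: Marcus2018, Ch. 4 Ex. 32] -/
theorem layer_vanishing {M : Type*} [AddCommGroup M] (hM : Nat.card M = 2) :
    ∀ (n : ℕ) (χ : absoluteGaloisGroup ℚ → M),
      (∀ x ∈ (CyclotomicZp.zpExtension 2).layerSubgroup n, ∀ y ∈ (CyclotomicZp.zpExtension 2).layerSubgroup n,
        χ (x * y) = χ x + χ y) →
      (∃ U : Subgroup (absoluteGaloisGroup ℚ), IsOpen (U : Set (absoluteGaloisGroup ℚ)) ∧
        U ≤ (CyclotomicZp.zpExtension 2).layerSubgroup n ∧ ∀ x ∈ U, χ x = 0) →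
      (∀ v : HeightOneSpectrum (𝓞 ℚ), ((2 : ℕ) : 𝓞 ℚ) ∉ v.asIdeal →
        ∀ 𝔓 ∈ v.primesAbove, ∀ x ∈ 𝔓.inertia (absoluteGaloisGroup ℚ), χ x = 0) →
      (∀ c₀ : absoluteGaloisGroup ℚ, IsComplexConjugation (Rat.castHom ℝ) c₀ → χ c₀ = 0) →
      ∀ x ∈ (CyclotomicZp.zpExtension 2).layerSubgroup (n + 1), χ x = 0 := by
  set κ := CyclotomicZp.zpExtension 2 with hκdef
  have hκ : κ.IsCyclotomic := CyclotomicZp.isCyclotomic_zpExtension 2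
  intro n
  induction n with
  | zero =>
    intro χ hadd hU hI hcc
    rw [ZpExtension.layerSubgroup_zero] at hadd hU
    -- `χ` is a homomorphism on all of `Γ_ℚ`; its kernel `N`
    let f : absoluteGaloisGroup ℚ →* Multiplicative M :=
      { toFun := fun x ↦ Multiplicative.ofAdd (χ x)
        map_one' := by
          have h := hadd 1 (Subgroup.mem_top _) 1 (Subgroup.mem_top _)
          rw [mul_one] at h
          rw [left_eq_add.mp h]; rfl
        map_mul' := fun x y ↦ by rw [hadd x (Subgroup.mem_top _) y (Subgroup.mem_top _), ofAdd_add] }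
    set N : Subgroup (absoluteGaloisGroup ℚ) := f.ker with hN
    have hmemN : ∀ x, x ∈ N ↔ χ x = 0 := fun x ↦ by
      rw [hN, MonoidHom.mem_ker]
      exact ⟨fun h ↦ Multiplicative.ofAdd.injective h, fun h ↦ by change Multiplicative.ofAdd (χ x) = 1; rw [h]; rfl⟩
    obtain ⟨U, hUo, -, hUχ⟩ := hU
    have hUN : U ≤ N := fun x hx ↦ (hmemN x).mpr (hUχ x hx)
    have hNo : IsOpen (N : Set (absoluteGaloisGroup ℚ)) := Subgroup.isOpen_mono hUN hUo
    by_cases htop : N = ⊤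
    · intro x _
      exact (hmemN x).mp (htop ▸ Subgroup.mem_top x)
    -- index `2`
    have hidx : N.index = 2 := by
      have h1 : N.index ∣ 2 := by
        rw [hN, Subgroup.index_ker, ← hM]
        exact Subgroup.card_subgroup_dvd_card f.range
      rcases (Nat.dvd_prime Nat.prime_two).mp h1 with h | h
      · exact absurd (Subgroup.index_eq_one.mp h) htop
      · exact h
    have hN1 := eq_layerSubgroup_one_of_index_two N hNo hidx
      (fun v hv 𝔓 h𝔓 x hx ↦ (hmemN x).mpr (hI v hv 𝔓 h𝔓 x hx)) (fun c₀ hc₀ ↦ (hmemN c₀).mpr (hcc c₀ hc₀))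
    intro x hx
    rw [zero_add, hκdef, ← hN1] at hx
    exact (hmemN x).mp hx
  | succ n ih =>
    intro χ hadd hU hI hcc
    set H := κ.layerSubgroup (n + 1) with hH
    obtain ⟨s, hs, hs'⟩ := exists_mem_layerSubgroup_not_mem_succ κ n
    obtain ⟨hss, hss'⟩ := sq_mem_layerSubgroup_succ_not_mem κ hs hs'
    obtain ⟨U, hUo, hUle, hUχ⟩ := hU
    have hχ1 : χ 1 = 0 := by
      have h := hadd 1 (one_mem _) 1 (one_mem _)
      rw [mul_one] at h
      exact left_eq_add.mp h
    have hconjH : ∀ x ∈ H, s⁻¹ * x * s ∈ H := fun x hx ↦ by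
      have := (κ.layerSubgroup_normal (n + 1)).conj_mem x hx s⁻¹
      rwa [inv_inv] at this
    -- inertia and complex conjugations lie in `G = ker κ ≤ Γ_{n+2} ≤ H`, stably under conjugation
    have hIconj : ∀ (t : absoluteGaloisGroup ℚ) (v : HeightOneSpectrum (𝓞 ℚ)), ((2 : ℕ) : 𝓞 ℚ) ∉ v.asIdeal →
        ∀ 𝔓 ∈ v.primesAbove, ∀ x ∈ 𝔓.inertia (absoluteGaloisGroup ℚ), χ (t⁻¹ * x * t) = 0 := by
      intro t v hv 𝔓 h𝔓 x hx
      refine hI v hv (t⁻¹ • 𝔓) (PrintCFram.HerbrandSelmerToHom.smul_mem_primesAbove h𝔓 t⁻¹) _ ?_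
      have h := PrintCFram.HerbrandSelmerToHom.conj_mem_inertia_of_mem (𝔓 := t⁻¹ • 𝔓) (τ := t) (n := x)
        (by rwa [smul_inv_smul])
      exact h
    have hccconj : ∀ (t c₀ : absoluteGaloisGroup ℚ), IsComplexConjugation (Rat.castHom ℝ) c₀ → χ (t⁻¹ * c₀ * t) = 0 :=
      fun t c₀ hc₀ ↦ hcc _ (hc₀.of_isConj (isConj_iff.mpr ⟨t⁻¹, by simp [mul_assoc]⟩))
    -- the generic extension-and-descend step: an `s`-invariant additive `d` on `H` with `d(s s) = 0`, open kernel and the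
    -- local vanishing, vanishes on `H`
    have step : ∀ d : absoluteGaloisGroup ℚ → M,
        (∀ x ∈ H, ∀ y ∈ H, d (x * y) = d x + d y) → (∀ x ∈ H, d (s⁻¹ * x * s) = d x) → d (s * s) = 0 →
        (∃ V : Subgroup (absoluteGaloisGroup ℚ), IsOpen (V : Set (absoluteGaloisGroup ℚ)) ∧ V ≤ H ∧ ∀ x ∈ V, d x = 0) →
        (∀ v : HeightOneSpectrum (𝓞 ℚ), ((2 : ℕ) : 𝓞 ℚ) ∉ v.asIdeal →
          ∀ 𝔓 ∈ v.primesAbove, ∀ x ∈ 𝔓.inertia (absoluteGaloisGroup ℚ), d x = 0) →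
        (∀ c₀ : absoluteGaloisGroup ℚ, IsComplexConjugation (Rat.castHom ℝ) c₀ → d c₀ = 0) →
        ∀ x ∈ H, d x = 0 := by
      intro d hdadd hdinv hds2 hdV hdI hdcc
      set g : absoluteGaloisGroup ℚ → M := fun x ↦ if x ∈ H then d x else d (x * s⁻¹) with hgdef
      have hgH : ∀ x ∈ H, g x = d x := fun x hx ↦ by rw [hgdef]; exact if_pos hx
      have hgadd := extend_add κ n hs hs' d g hdadd hdinv hds2 (fun x ↦ rfl)
      obtain ⟨V, hVo, hVle, hVd⟩ := hdV
      have hg0 := ih g hgadd ⟨V, hVo, hVle.trans (κ.layerSubgroup_antitone (Nat.le_succ n)), fun x hx ↦ by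
          rw [hgH x (hVle hx)]; exact hVd x hx⟩
        (fun v hv 𝔓 h𝔓 x hx ↦ by
          rw [hgH x (inertia_le_layerSubgroup κ hκ hv h𝔓 (n + 1) hx)]; exact hdI v hv 𝔓 h𝔓 x hx)
        (fun c₀ hc₀ ↦ by
          rw [hgH c₀ (κ.kerSubgroup_le_layerSubgroup (n + 1) (mem_kerSubgroup_of_isComplexConjugation κ hc₀))]
          exact hdcc c₀ hc₀)
      intro x hx
      rw [← hgH x hx]
      exact hg0 x hx
    -- (1) `χ` is `s`-invariant on `H`: apply `step` to `d = χ + χ^s`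
    have hUso : IsOpen ((U.map (MulAut.conj s).toMonoidHom : Subgroup (absoluteGaloisGroup ℚ)) :
        Set (absoluteGaloisGroup ℚ)) := by
      have e : ((U.map (MulAut.conj s).toMonoidHom : Subgroup (absoluteGaloisGroup ℚ)) : Set (absoluteGaloisGroup ℚ)) =
          (fun x ↦ s⁻¹ * x * s) ⁻¹' (U : Set (absoluteGaloisGroup ℚ)) := by
        ext x
        simp only [SetLike.mem_coe, Set.mem_preimage, Subgroup.mem_map_equiv, MulAut.conj_symm_apply]
      rw [e]
      exact hUo.preimage ((continuous_const.mul continuous_id).mul continuous_const)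
    have hmemUs : ∀ x, x ∈ U.map (MulAut.conj s).toMonoidHom ↔ s⁻¹ * x * s ∈ U := fun x ↦ by
      rw [Subgroup.mem_map_equiv, MulAut.conj_symm_apply]
    have hinv : ∀ x ∈ H, χ (s⁻¹ * x * s) = χ x := by
      set d : absoluteGaloisGroup ℚ → M := fun x ↦ χ x + χ (s⁻¹ * x * s) with hddef
      have hdx : ∀ x, d x = χ x + χ (s⁻¹ * x * s) := fun _ ↦ rfl
      have h := step d
        (fun x hx y hy ↦ by
          rw [hdx, hdx, hdx, show s⁻¹ * (x * y) * s = (s⁻¹ * x * s) * (s⁻¹ * y * s) by group, hadd x hx y hy,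
            hadd _ (hconjH x hx) _ (hconjH y hy)]
          abel)
        (fun x hx ↦ by
          rw [hdx, hdx]
          have e : s⁻¹ * (s⁻¹ * x * s) * s = (s * s)⁻¹ * (x * (s * s)) := by group
          have hi : χ (s * s)⁻¹ + χ (s * s) = 0 := by
            rw [← hadd _ (inv_mem hss) _ hss, inv_mul_cancel, hχ1]
          have h2 : χ (s⁻¹ * (s⁻¹ * x * s) * s) = χ x := by
            rw [e, hadd _ (inv_mem hss) _ (mul_mem hx hss), hadd x hx _ hss]
            calc χ (s * s)⁻¹ + (χ x + χ (s * s))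
                = χ x + (χ (s * s)⁻¹ + χ (s * s)) := by abel
              _ = χ x := by rw [hi, add_zero]
          rw [h2, add_comm])
        (by
          rw [hdx, show s⁻¹ * (s * s) * s = s * s by group]
          exact add_self_eq_zero_of_card_eq_two hM _)
        ⟨U ⊓ U.map (MulAut.conj s).toMonoidHom, hUo.inter hUso, inf_le_left.trans hUle, fun x hx ↦ by
          obtain ⟨hxU, hxUs⟩ := Subgroup.mem_inf.mp hx
          rw [hdx, hUχ x hxU, hUχ _ ((hmemUs x).mp hxUs), add_zero]⟩
        (fun v hv 𝔓 h𝔓 x hx ↦ by rw [hdx, hI v hv 𝔓 h𝔓 x hx, hIconj s v hv 𝔓 h𝔓 x hx, add_zero])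
        (fun c₀ hc₀ ↦ by rw [hdx, hcc c₀ hc₀, hccconj s c₀ hc₀, add_zero])
      intro x hx
      have hx0 := h x hx
      rw [hdx] at hx0
      exact ((add_eq_zero_iff_eq_of_card_eq_two hM).mp hx0).symm
    -- (2) case split on `χ (s s)`
    have hle2 : κ.layerSubgroup (n + 1 + 1) ≤ H := κ.layerSubgroup_antitone (Nat.le_succ _)
    by_cases hχs2 : χ (s * s) = 0
    · -- `χ` itself extends: `χ = 0` on `H ⊇ Γ_{n+2}`
      have h := step χ hadd hinv hχs2 ⟨U, hUo, hUle, hUχ⟩ hI hcc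
      intro x hx
      exact h x (hle2 hx)
    · -- `χ + ψ` extends, `ψ` the character of `ℚ_{n+2}/ℚ_{n+1}`
      set H2 := κ.layerSubgroup (n + 1 + 1) with hH2
      set ψ : absoluteGaloisGroup ℚ → M := fun x ↦ if x ∈ H2 then 0 else χ (s * s) with hψdef
      have hψ0 : ∀ x ∈ H2, ψ x = 0 := fun x hx ↦ by rw [hψdef]; exact if_pos hx
      have hψ1 : ∀ x ∉ H2, ψ x = χ (s * s) := fun x hx ↦ by rw [hψdef]; exact if_neg hx
      have hψadd : ∀ x ∈ H, ∀ y ∈ H, ψ (x * y) = ψ x + ψ y := by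
        intro x hx y hy
        have hrule := mul_mem_layerSubgroup_succ_iff κ (n + 1) hx hy
        by_cases hxH2 : x ∈ H2 <;> by_cases hyH2 : y ∈ H2
        · rw [hψ0 _ (hrule.mpr (iff_of_true hxH2 hyH2)), hψ0 x hxH2, hψ0 y hyH2, add_zero]
        · rw [hψ1 _ (fun h ↦ hyH2 ((hrule.mp h).mp hxH2)), hψ0 x hxH2, hψ1 y hyH2, zero_add]
        · rw [hψ1 _ (fun h ↦ hxH2 ((hrule.mp h).mpr hyH2)), hψ1 x hxH2, hψ0 y hyH2, add_zero]
        · rw [hψ0 _ (hrule.mpr (iff_of_false hxH2 hyH2)), hψ1 x hxH2, hψ1 y hyH2,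
            add_self_eq_zero_of_card_eq_two hM]
      have hψinv : ∀ x, ψ (s⁻¹ * x * s) = ψ x := fun x ↦ by
        have hiff : s⁻¹ * x * s ∈ H2 ↔ x ∈ H2 := by
          constructor
          · intro h
            have := (κ.layerSubgroup_normal (n + 1 + 1)).conj_mem _ h s
            rwa [show s * (s⁻¹ * x * s) * s⁻¹ = x by group] at this
          · intro h
            have := (κ.layerSubgroup_normal (n + 1 + 1)).conj_mem _ h s⁻¹
            rwa [inv_inv] at this
        by_cases hx : x ∈ H2
        · rw [hψ0 x hx, hψ0 _ (hiff.mpr hx)]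
        · rw [hψ1 x hx, hψ1 _ (fun h ↦ hx (hiff.mp h))]
      set e : absoluteGaloisGroup ℚ → M := fun x ↦ χ x + ψ x with hedef
      have hex : ∀ x, e x = χ x + ψ x := fun _ ↦ rfl
      have h := step e
        (fun x hx y hy ↦ by rw [hex, hex, hex, hadd x hx y hy, hψadd x hx y hy]; abel)
        (fun x hx ↦ by rw [hex, hex, hinv x hx, hψinv x])
        (by rw [hex, hψ1 _ hss', add_self_eq_zero_of_card_eq_two hM])
        ⟨U ⊓ H2, hUo.inter (ZpExtension.isOpen_layerSubgroup κ (n + 1 + 1)), inf_le_left.trans hUle, fun x hx ↦ by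
          obtain ⟨hxU, hx2⟩ := Subgroup.mem_inf.mp hx
          rw [hex, hUχ x hxU, hψ0 x hx2, add_zero]⟩
        (fun v hv 𝔓 h𝔓 x hx ↦ by
          rw [hex, hI v hv 𝔓 h𝔓 x hx, hψ0 x (inertia_le_layerSubgroup κ hκ hv h𝔓 (n + 1 + 1) hx), add_zero])
        (fun c₀ hc₀ ↦ by
          rw [hex, hcc c₀ hc₀, hψ0 c₀ (κ.kerSubgroup_le_layerSubgroup (n + 1 + 1)
            (mem_kerSubgroup_of_isComplexConjugation κ hc₀)), add_zero])
      intro x hx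
      have hx0 := h x (hle2 hx)
      rwa [hex, hψ0 x hx, add_zero] at hx0

end Summit.BirchSwinnertonDyer.BirchSwinnertonDyer.Theorems.TwoAdicWbarStep

end
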